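import Summits.HubbardSuperconductivity.HubbardSuperconductivity.Theorems.ColourTheSpinSgEndpointPenalisedChord
import Summits.HubbardSuperconductivity.HubbardSuperconductivity.Theorems.ColourTheSpinSgEndpointStubPureGaugeDictionary
import Literature.MathematicalPhysics.QuantumLattice.HubbardRingPerronFrobeniusProofs
import Literature.MathematicalPhysics.QuantumLattice.PairFieldEvenSideLRO
import Summits.HubbardSuperconductivity.HubbardSuperconductivity.Theses.ColourTheSpin
import HarnessLib

/-!
# Crux `SgEndpoint` (stmt-HubbardSuperconductivity-16272, route `ColourTheSpin`), alt line
# `penalty_chord`: stub P3 `stub_penalisedEndpoint` — file 2/2: the penalised endpoint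

The registered stub P3 of the strategist's line `Cruxes/SgEndpoint/Lines/penalty_chord.lean`
(`Sig.stub_penalisedEndpoint`, verbatim; = the DOOR item `SgEndpointP` of
`Cruxes/SgEndpoint/STRATEGY-CENSUS.md` §8):

PENALISED corridor order at `(g₁, c₁, κ, L₂)` (every ground state of the `N_L`-block of
`H_g + (κ/L⁴) Δ^g†Δ^g` has `⟨Δ^g†Δ^g⟩ ≥ c₁L⁴‖ψ‖²` for `g ∈ (0, g₁]`, even `L ≥ L₂`) and a twist gap
`≤ κc₁/2` from `L₃` on (no flat `Q₈` link configuration has an `N_L`-particle frozen Rayleigh quotient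
more than `κc₁/2` below the `N_L`-block ground energy of the periodic torus) imply: for `a = c₁` and
every even `L ≥ max L₂ (max L₃ 3)`, EVERY normalised `(N_L, S^z = 0)`-sector ground state `ψ` of
`hubbardTorus 2 L 1 U` has `a·L⁴ ≤ Re ⟨ψ, Δ_d†Δ_d ψ⟩`.

## Proof (energies, no selection)

With `e = min_{flat} e₀`, `eP(k) = min Rayleigh_N (H_F(k) + κ' P_k†P_k)`, `κ' = κ/L⁴`:
(1) the chord at fixed `g` (`penalised_chord`, file 1/2) along `g_n → 0⁺` gives
`e + κ' c₁ L⁴ ≤ eP(1)` (`chord_limit`); (2) the twist-gap hypothesis at a flat minimiser gives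
`e ≥ e_per - κc₁/2`, `e_per` the `N_L`-block ground energy of the torus; (3) by `SU(2)` the
`(N_L, S^z = 0)`-sector ground energy is `e_per` (`groundEnergyAt_eq_minEnergyOn_szSector`), so a
sector ground state `ψ` is an `N_L`-particle unit vector with `Re ⟨ψ, H_F(1) ψ⟩ = e_per`
(`H_F(1) = hubbardTorus`, `hamiltonianBlock_one`); (4) `Re ⟨ψ, (H_F(1) + κ'P_1†P_1) ψ⟩ ≥ eP(1)` and
`P_1 = Δ_d/√2` (`pairFieldBlock_one`) give `e_per + (κ'/2) Re⟨Δ_d†Δ_d⟩ ≥ e_per + κc₁/2`.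

Kaplan–Horsch–von der Linden, J. Phys. Soc. Jpn. 58 (1989) 3894 (disfavouring source);
Kogut–Susskind, PRD 11 (1975) 395; Lieb, PRL 62 (1989) 1201 (`S^z = 0` representatives);
Scalapino, Phys. Rep. 250 (1995) 329 §2.
-/

noncomputable section

namespace Summit.HubbardSuperconductivity.ColourTheSpin.SgEndpoint

open Matrix Finset Filter Topology Literature.MathematicalPhysics.QuantumLattice SpinGauged GaugedHubbard
open scoped ComplexOrder Kronecker

section Main

variable (L : ℕ) [NeZero L] (U : ℝ)

/-! ### Flat minimisers of the frozen energy -/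

/-- **A flat configuration minimising the frozen `N`-block energy among flat configurations exists**
(the trivial configuration is flat; finitely many configurations). [folklore] -/
theorem exists_flat_minimiser (N : ℕ) :
    ∃ k₀ : Bond L → Q8, (∀ x, holonomy L k₀ x = 1) ∧ ∀ k : Bond L → Q8, (∀ x, holonomy L k x = 1) →
      ((spinGaugedHubbardTorusWith Q8.rep L U 0 0).submatrix (fun s => (s, k₀)) (fun s => (s, k₀))).minEnergyOn
          (nParticleSubmodule N : Submodule ℂ (Fock (Orb (FermionTorus 2 L)))) ≤
        ((spinGaugedHubbardTorusWith Q8.rep L U 0 0).submatrix (fun s => (s, k)) (fun s => (s, k))).minEnergyOn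
          (nParticleSubmodule N : Submodule ℂ (Fock (Orb (FermionTorus 2 L)))) := by
  classical
  obtain ⟨k₀, hk₀, hmin⟩ := Finset.exists_min_image
    (Finset.univ.filter fun k : Bond L → Q8 => ∀ x, holonomy L k x = 1)
    (fun k => ((spinGaugedHubbardTorusWith Q8.rep L U 0 0).submatrix (fun s => (s, k)) (fun s => (s, k))).minEnergyOn
      (nParticleSubmodule N : Submodule ℂ (Fock (Orb (FermionTorus 2 L)))))
    ⟨1, by simp⟩
  rw [Finset.mem_filter] at hk₀
  exact ⟨k₀, hk₀.2, fun k hk => hmin k (Finset.mem_filter.2 ⟨Finset.mem_univ _, hk⟩)⟩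

/-! ### The chord in the limit `g → 0⁺` -/

/-- **The chord survives `g → 0⁺`.** If the penalised corridor clause holds at side `L` for every
`g ∈ (0, g₁]` with constant `c` and source `κ' ≥ 0`, then for every flat `k` and every flat minimiser
`k₀` of the unpenalised frozen energy: `e₀(k₀) + κ' c ≤ eP(k)`. [folklore] -/
theorem chord_limit {N : ℕ} (hN : ∃ s : Finset (Orb (FermionTorus 2 L)), s.card = N)
    {g₁ κ' c : ℝ} (hg₁ : 0 < g₁) (hκ : 0 ≤ κ')
    (hPen : ∀ g : ℝ, 0 < g → g ≤ g₁ →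
      ∀ ψ : {ik : Index L Q8 // HasParticleNumber L N ik} → ℂ,
        (ψ ≠ 0 ∧ ∃ E : ℝ, (spinGaugedHubbardTorus L U g +
            ((κ' : ℝ) : ℂ) • ((spinGaugedPairField L)ᴴ * spinGaugedPairField L)).toBlock
              (HasParticleNumber L N) (HasParticleNumber L N) *ᵥ ψ = (E : ℂ) • ψ ∧
          ∀ φ : {ik : Index L Q8 // HasParticleNumber L N ik} → ℂ,
            E * (star φ ⬝ᵥ φ).re ≤
              (star φ ⬝ᵥ (spinGaugedHubbardTorus L U g +
                ((κ' : ℝ) : ℂ) • ((spinGaugedPairField L)ᴴ * spinGaugedPairField L)).toBlock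
                  (HasParticleNumber L N) (HasParticleNumber L N) *ᵥ φ).re) →
        c * (star ψ ⬝ᵥ ψ).re ≤
          (star ψ ⬝ᵥ ((spinGaugedPairField L)ᴴ * spinGaugedPairField L).toBlock
            (HasParticleNumber L N) (HasParticleNumber L N) *ᵥ ψ).re)
    (k₀ : Bond L → Q8)
    (hmin : ∀ k : Bond L → Q8, (∀ x, holonomy L k x = 1) →
      ((spinGaugedHubbardTorusWith Q8.rep L U 0 0).submatrix (fun s => (s, k₀)) (fun s => (s, k₀))).minEnergyOn
          (nParticleSubmodule N : Submodule ℂ (Fock (Orb (FermionTorus 2 L)))) ≤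
        ((spinGaugedHubbardTorusWith Q8.rep L U 0 0).submatrix (fun s => (s, k)) (fun s => (s, k))).minEnergyOn
          (nParticleSubmodule N : Submodule ℂ (Fock (Orb (FermionTorus 2 L)))))
    (k : Bond L → Q8) (hk : ∀ x, holonomy L k x = 1) :
    ((spinGaugedHubbardTorusWith Q8.rep L U 0 0).submatrix (fun s => (s, k₀)) (fun s => (s, k₀))).minEnergyOn
          (nParticleSubmodule N : Submodule ℂ (Fock (Orb (FermionTorus 2 L)))) + κ' * c ≤
      ((spinGaugedHubbardTorusWith Q8.rep L U 0 0).submatrix (fun s => (s, k)) (fun s => (s, k)) +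
          ((κ' : ℝ) : ℂ) • ((((spinGaugedPairField L).submatrix (fun s => (s, k)) (fun s => (s, k)))ᴴ *
            (spinGaugedPairField L).submatrix (fun s => (s, k)) (fun s => (s, k))))).minEnergyOn
            (nParticleSubmodule N : Submodule ℂ (Fock (Orb (FermionTorus 2 L)))) := by
  -- names
  set A := spinGaugedHubbardTorusWith Q8.rep L U 0 0 with hAdef
  set R := (spinGaugedPairField L)ᴴ * spinGaugedPairField L with hRdef
  set e : ℝ := (A.submatrix (fun s => (s, k₀)) (fun s => (s, k₀))).minEnergyOn
    (nParticleSubmodule N : Submodule ℂ (Fock (Orb (FermionTorus 2 L)))) with hedef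
  set eP : ℝ := (A.submatrix (fun s => (s, k)) (fun s => (s, k)) +
      ((κ' : ℝ) : ℂ) • ((((spinGaugedPairField L).submatrix (fun s => (s, k)) (fun s => (s, k)))ᴴ *
        (spinGaugedPairField L).submatrix (fun s => (s, k)) (fun s => (s, k))))).minEnergyOn
    (nParticleSubmodule N : Submodule ℂ (Fock (Orb (FermionTorus 2 L)))) with hePdef
  set EA : ℝ := A.groundEnergy with hEAdef
  set cE : ℝ := (Fintype.card (Bond L) : ℝ) * (1 - 1 / 8) with hcE
  -- couplings `g_n = g₁ / (n + 2) → 0⁺`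
  set g : ℕ → ℝ := fun n => g₁ / ((n : ℝ) + 2) with hgdef
  have hgpos : ∀ n, 0 < g n := fun n => by positivity
  have hgle : ∀ n, g n ≤ g₁ := fun n => by
    rw [hgdef]
    dsimp only
    rw [div_le_iff₀ (by positivity)]
    nlinarith [(Nat.cast_nonneg n : (0 : ℝ) ≤ n)]
  have hgto : Tendsto g atTop (𝓝 0) := by
    have h1 : Tendsto (fun n : ℕ => (n : ℝ) + 2) atTop atTop :=
      tendsto_atTop_add_const_right atTop 2 tendsto_natCast_atTop_atTop
    have h3 : Tendsto (fun n : ℕ => g₁ * ((n : ℝ) + 2)⁻¹) atTop (𝓝 (g₁ * 0)) :=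
      h1.inv_tendsto_atTop.const_mul g₁
    rw [mul_zero] at h3
    refine h3.congr fun n => ?_
    rw [hgdef]
    dsimp only
    rw [div_eq_mul_inv]
  have hg2to : Tendsto (fun n => g n ^ 2) atTop (𝓝 0) := by
    simpa using hgto.pow 2
  -- eventually `e - EA ≤ 1 / (g n)²`
  obtain ⟨n₀, hn₀⟩ := exists_nat_ge (g₁ ^ 2 * |e - EA|)
  have hsmall : ∀ n, n₀ ≤ n → e - EA ≤ 1 / g n ^ 2 := by
    intro n hn
    have hn' : (n₀ : ℝ) ≤ n := by exact_mod_cast hn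
    have h1 : 1 / g n ^ 2 = ((n : ℝ) + 2) ^ 2 / g₁ ^ 2 := by
      rw [hgdef]
      dsimp only
      rw [div_pow, one_div, inv_div]
    rw [h1, le_div_iff₀ (by positivity)]
    have h2 : e - EA ≤ |e - EA| := le_abs_self _
    have h3 : (0 : ℝ) ≤ |e - EA| := abs_nonneg _
    have h4 : ((n : ℝ) + 2) ^ 2 ≥ (n : ℝ) := by nlinarith [(Nat.cast_nonneg n : (0 : ℝ) ≤ n)]
    have h5 : 0 < g₁ ^ 2 := by positivity
    nlinarith [mul_le_mul_of_nonneg_left h2 h5.le]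
  -- the chord at each such `n`
  have hchord : ∀ n, n₀ ≤ n → e + κ' * c ≤ eP + g n ^ 2 * cE := by
    intro n hn
    obtain ⟨χ, hχsupp, hχ1, E, hEeig, hEray⟩ :=
      exists_groundState_cardBlock_penalised L U (g n) κ' hN
    have hχ0 : χ ≠ 0 := by
      intro h0
      have := hχ1
      rw [h0, dotProduct_zero] at this
      exact zero_ne_one this
    have hord : c ≤ (star χ ⬝ᵥ R *ᵥ χ).re := by
      have h := corridor_order_of_blockGroundState L
        (spinGaugedHubbardTorus L U (g n) + ((κ' : ℝ) : ℂ) • R) R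
        (hPen (g n) (hgpos n) (hgle n)) hχsupp hχ0 hEeig hEray
      rwa [hχ1, Complex.one_re, mul_one] at h
    exact penalised_chord L U hN (hgpos n) k₀ hmin (hsmall n hn) hκ hχsupp hχ1 hEeig hEray hord k hk
  -- pass to the limit
  have hlim : Tendsto (fun n => eP + g n ^ 2 * cE) atTop (𝓝 eP) := by
    have h0 : Tendsto (fun n => eP + g n ^ 2 * cE) atTop (𝓝 (eP + 0 * cE)) :=
      tendsto_const_nhds.add (hg2to.mul_const cE)
    rw [zero_mul, add_zero] at h0
    exact h0
  exact ge_of_tendsto hlim (Filter.eventually_atTop.2 ⟨n₀, hchord⟩)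

/-! ### The dictionary at the trivial configuration -/

/-- `H_F(1) = hubbardTorus 2 L 1 U` for `L ≥ 3` (landed `hamiltonianBlock_one`). [folklore] -/
theorem frozen_one_eq_hubbardTorus (hL : 3 ≤ L) :
    (spinGaugedHubbardTorusWith Q8.rep L U 0 0).submatrix (fun s => (s, (1 : Bond L → Q8))) (fun s => (s, 1)) =
      hubbardTorus 2 L 1 U :=
  hamiltonianBlock_one L hL U

/-- `P_1† P_1 = ½ Δ_d† Δ_d` (landed `pairFieldBlock_one`: `P_1 = Δ_d/√2`). [folklore] -/
theorem frozenPairOrder_one :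
    ((spinGaugedPairField L).submatrix (fun s => (s, (1 : Bond L → Q8))) (fun s => (s, 1)))ᴴ *
        (spinGaugedPairField L).submatrix (fun s => (s, (1 : Bond L → Q8))) (fun s => (s, 1)) =
      (((1 : ℝ) / 2 : ℝ) : ℂ) • ((pairField dWaveFormFactor L)ᴴ * pairField dWaveFormFactor L) := by
  have h : (spinGaugedPairField L).submatrix (fun s => (s, (1 : Bond L → Q8))) (fun s => (s, 1)) =
      (((Real.sqrt 2)⁻¹ : ℝ) : ℂ) • pairField dWaveFormFactor L := pairFieldBlock_one L
  rw [h, conjTranspose_smul, smul_mul_smul_comm, Complex.star_def, Complex.conj_ofReal, ← Complex.ofReal_mul]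
  congr 1
  rw [← mul_inv, Real.mul_self_sqrt two_pos.le, one_div]

/-! ### `SU(2)`: the sector ground energy is the block ground energy -/

omit [NeZero L] in
/-- **The `(2n, S^z = 0)`-sector ground energy of the torus equals its `2n`-block ground energy**
(every multiplet is represented at `S^z = 0`; landed `groundEnergyAt_eq_minEnergyOn_szSector`).
[folklore] -/
theorem minEnergyOn_szSector_eq (n : ℕ) (hn : n ≤ Fintype.card (FermionTorus 2 L)) :
    (hubbardTorus 2 L 1 U).minEnergyOn (szSector (Λ := FermionTorus 2 L) (2 * n) 0) =
      (hubbardTorus 2 L 1 U).minEnergyOn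
        (nParticleSubmodule (2 * n) : Submodule ℂ (Fock (Orb (FermionTorus 2 L)))) := by
  have h1 := groundEnergyAt_eq_minEnergyOn_szSector (fermionTorusGraph 2 L) 1 U hn
  have h2 : groundEnergyAt (fermionTorusGraph 2 L) 1 U (2 * n) =
      (hubbardTorus 2 L 1 U).minEnergyOn
        (nParticleSubmodule (2 * n) : Submodule ℂ (Fock (Orb (FermionTorus 2 L)))) :=
    groundEnergy_eq_minEnergyOn _ _ _ (mem_nParticleSubmodule_iff _)
  rw [← h2, h1]
  rfl

/-! ### The penalised endpoint over the landed vocabulary -/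

/-- **The penalised endpoint** (stub P3 over the landed vocabulary): penalised corridor order at
`(g₁, c₁, κ, L₂)` and twist gap `≤ κc₁/2` from `L₃` on imply that every normalised
`(N_L, S^z = 0)`-sector ground state of `hubbardTorus 2 L 1 U` has `c₁·L⁴ ≤ Re ⟨ψ, Δ_d†Δ_d ψ⟩` for all
even `L ≥ max L₂ (max L₃ 3)`. [folklore] -/
theorem penalisedEndpoint_landed (U δ g₁ c₁ κ : ℝ) (L₂ L₃ : ℕ) (hδ : δ ∈ Set.Ioo (0 : ℝ) (1 / 2))
    (hg₁ : 0 < g₁) (hc₁ : 0 < c₁) (hκ : 0 < κ)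
    (hPen : ∀ g : ℝ, 0 < g → g ≤ g₁ → ∀ (L : ℕ) [NeZero L], L₂ ≤ L → Even L →
      ∀ ψ : {ik : Index L Q8 // HasParticleNumber L (2 * ⌊(1 - δ) * (L : ℝ) ^ 2 / 2⌋₊) ik} → ℂ,
        (ψ ≠ 0 ∧ ∃ E : ℝ, (spinGaugedHubbardTorus L U g +
            ((κ / (L : ℝ) ^ 4 : ℝ) : ℂ) • ((spinGaugedPairField L)ᴴ * spinGaugedPairField L)).toBlock
              (HasParticleNumber L (2 * ⌊(1 - δ) * (L : ℝ) ^ 2 / 2⌋₊))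
              (HasParticleNumber L (2 * ⌊(1 - δ) * (L : ℝ) ^ 2 / 2⌋₊)) *ᵥ ψ = (E : ℂ) • ψ ∧
          ∀ φ : {ik : Index L Q8 // HasParticleNumber L (2 * ⌊(1 - δ) * (L : ℝ) ^ 2 / 2⌋₊) ik} → ℂ,
            E * (star φ ⬝ᵥ φ).re ≤
              (star φ ⬝ᵥ (spinGaugedHubbardTorus L U g +
                ((κ / (L : ℝ) ^ 4 : ℝ) : ℂ) • ((spinGaugedPairField L)ᴴ * spinGaugedPairField L)).toBlock
                  (HasParticleNumber L (2 * ⌊(1 - δ) * (L : ℝ) ^ 2 / 2⌋₊))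
                  (HasParticleNumber L (2 * ⌊(1 - δ) * (L : ℝ) ^ 2 / 2⌋₊)) *ᵥ φ).re) →
        c₁ * (L : ℝ) ^ 4 * (star ψ ⬝ᵥ ψ).re ≤
          (star ψ ⬝ᵥ ((spinGaugedPairField L)ᴴ * spinGaugedPairField L).toBlock
            (HasParticleNumber L (2 * ⌊(1 - δ) * (L : ℝ) ^ 2 / 2⌋₊))
            (HasParticleNumber L (2 * ⌊(1 - δ) * (L : ℝ) ^ 2 / 2⌋₊)) *ᵥ ψ).re)
    (hTw : ∀ (L : ℕ) [NeZero L], L₃ ≤ L → Even L → ∀ k : Bond L → Q8, (∀ x, holonomy L k x = 1) →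
      ∀ φ : Fock (Orb (FermionTorus 2 L)),
        φ ∈ (nParticleSubmodule (2 * ⌊(1 - δ) * (L : ℝ) ^ 2 / 2⌋₊) : Submodule ℂ (Fock (Orb (FermionTorus 2 L)))) →
          ((hubbardTorus 2 L 1 U).minEnergyOn
              (nParticleSubmodule (2 * ⌊(1 - δ) * (L : ℝ) ^ 2 / 2⌋₊) : Submodule ℂ (Fock (Orb (FermionTorus 2 L)))) -
            κ * c₁ / 2) * (star φ ⬝ᵥ φ).re ≤
          (star φ ⬝ᵥ (spinGaugedHubbardTorusWith Q8.rep L U 0 0).submatrix (fun s => (s, k)) (fun s => (s, k)) *ᵥ φ).re) :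
    ∃ a : ℝ, 0 < a ∧ ∃ L₄ : ℕ, ∀ (L : ℕ) [NeZero L], L₄ ≤ L → Even L →
      ∀ ψ : Fock (Orb (FermionTorus 2 L)), star ψ ⬝ᵥ ψ = 1 →
        IsGroundStateInSector (hubbardTorus 2 L 1 U) (2 * ⌊(1 - δ) * (L : ℝ) ^ 2 / 2⌋₊) 0 ψ →
          a * (L : ℝ) ^ 4 ≤ (expect ((pairField dWaveFormFactor L)ᴴ * pairField dWaveFormFactor L) ψ).re := by
  refine ⟨c₁, hc₁, max L₂ (max L₃ 3), fun L _ hL hE ψ hψ1 hgs => ?_⟩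
  have hL₂ : L₂ ≤ L := le_trans (le_max_left _ _) hL
  have hL₃ : L₃ ≤ L := le_trans ((le_max_left _ _).trans (le_max_right _ _)) hL
  have hL3 : 3 ≤ L := le_trans ((le_max_right _ _).trans (le_max_right _ _)) hL
  have hN : ∃ s : Finset (Orb (FermionTorus 2 L)), s.card = 2 * ⌊(1 - δ) * (L : ℝ) ^ 2 / 2⌋₊ :=
    exists_card_eq_blockNumber L hδ
  have hLpos : (0 : ℝ) < L := by exact_mod_cast Nat.pos_of_ne_zero (NeZero.ne L)
  have hL4 : (0 : ℝ) < (L : ℝ) ^ 4 := by positivity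
  have hκ' : 0 < κ / (L : ℝ) ^ 4 := div_pos hκ hL4
  -- the sector ground state is an `N`-particle unit eigenvector at the block ground energy
  obtain ⟨hψsec, hψ0, hψeig⟩ := hgs
  have hψK : ψ ∈ (nParticleSubmodule (2 * ⌊(1 - δ) * (L : ℝ) ^ 2 / 2⌋₊) :
      Submodule ℂ (Fock (Orb (FermionTorus 2 L)))) := ((mem_szSector_iff _ _ _).1 hψsec).1
  have hn_le : ⌊(1 - δ) * (L : ℝ) ^ 2 / 2⌋₊ ≤ Fintype.card (FermionTorus 2 L) := by
    have hcard : Fintype.card (FermionTorus 2 L) = L ^ 2 := by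
      simp [FermionTorus, Fintype.card_lex]
    rw [hcard]
    have h1 : (⌊(1 - δ) * (L : ℝ) ^ 2 / 2⌋₊ : ℝ) ≤ (1 - δ) * (L : ℝ) ^ 2 / 2 :=
      Nat.floor_le (by nlinarith [hδ.1, hδ.2, sq_nonneg (L : ℝ)])
    have h2 : (1 - δ) * (L : ℝ) ^ 2 / 2 ≤ ((L ^ 2 : ℕ) : ℝ) := by
      rw [Nat.cast_pow]; nlinarith [hδ.1, hδ.2, sq_nonneg (L : ℝ)]
    exact_mod_cast h1.trans h2
  rw [minEnergyOn_szSector_eq L U _ hn_le] at hψeig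
  have hTform : (star ψ ⬝ᵥ hubbardTorus 2 L 1 U *ᵥ ψ).re =
      (hubbardTorus 2 L 1 U).minEnergyOn
        (nParticleSubmodule (2 * ⌊(1 - δ) * (L : ℝ) ^ 2 / 2⌋₊) : Submodule ℂ (Fock (Orb (FermionTorus 2 L)))) := by
    rw [EigenvalueContinuation.re_star_dotProduct_mulVec_of_eigen hψeig, hψ1, Complex.one_re, mul_one]
  -- the flat minimiser and the twist gap: `e ≥ e_per - κ c₁ / 2`
  obtain ⟨k₀, hflat₀, hmin₀⟩ := exists_flat_minimiser L U (2 * ⌊(1 - δ) * (L : ℝ) ^ 2 / 2⌋₊)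
  have htwist : (hubbardTorus 2 L 1 U).minEnergyOn
        (nParticleSubmodule (2 * ⌊(1 - δ) * (L : ℝ) ^ 2 / 2⌋₊) : Submodule ℂ (Fock (Orb (FermionTorus 2 L)))) -
        κ * c₁ / 2 ≤
      ((spinGaugedHubbardTorusWith Q8.rep L U 0 0).submatrix (fun s => (s, k₀)) (fun s => (s, k₀))).minEnergyOn
        (nParticleSubmodule (2 * ⌊(1 - δ) * (L : ℝ) ^ 2 / 2⌋₊) : Submodule ℂ (Fock (Orb (FermionTorus 2 L)))) := by
    obtain ⟨φ₀, hφ₀K, hφ₀1, hφ₀eig⟩ := exists_unit_groundState_frozen Q8.rep L Q8.star_trace_rep U k₀ hN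
    have h := hTw L hL₃ hE k₀ hflat₀ φ₀ hφ₀K
    rw [EigenvalueContinuation.re_star_dotProduct_mulVec_of_eigen hφ₀eig, hφ₀1, Complex.one_re, mul_one,
      mul_one] at h
    exact h
  -- the chord in the limit at `k = 1`: `e + κ' c₁ L⁴ ≤ eP(1)`
  have hchord := chord_limit L U hN hg₁ hκ'.le (fun g hg hgle => hPen g hg hgle L hL₂ hE) k₀ hmin₀ 1
    (holonomy_one L)
  -- the Rayleigh quotient of `ψ` in the penalised trivial block
  have hRHS : (star ψ ⬝ᵥ ((spinGaugedHubbardTorusWith Q8.rep L U 0 0).submatrix (fun s => (s, (1 : Bond L → Q8)))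
        (fun s => (s, 1)) +
      (((κ / (L : ℝ) ^ 4 : ℝ)) : ℂ) • ((((spinGaugedPairField L).submatrix (fun s => (s, (1 : Bond L → Q8)))
        (fun s => (s, 1)))ᴴ * (spinGaugedPairField L).submatrix (fun s => (s, (1 : Bond L → Q8))) (fun s => (s, 1))))) *ᵥ ψ).re =
      (hubbardTorus 2 L 1 U).minEnergyOn
        (nParticleSubmodule (2 * ⌊(1 - δ) * (L : ℝ) ^ 2 / 2⌋₊) : Submodule ℂ (Fock (Orb (FermionTorus 2 L)))) +
      κ / (L : ℝ) ^ 4 * (1 / 2 * (star ψ ⬝ᵥ ((pairField dWaveFormFactor L)ᴴ * pairField dWaveFormFactor L) *ᵥ ψ).re) := by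
    rw [add_mulVec, dotProduct_add, Complex.add_re, smul_mulVec, dotProduct_smul, smul_eq_mul,
      Complex.re_ofReal_mul, frozen_one_eq_hubbardTorus L U hL3, frozenPairOrder_one L, smul_mulVec,
      dotProduct_smul, smul_eq_mul, Complex.re_ofReal_mul, hTform]
  have hray := frozenPenalised_minEnergyOn_le_rayleigh L U (κ / (L : ℝ) ^ 4) (1 : Bond L → Q8) ψ hψK
  rw [hψ1, Complex.one_re, mul_one, hRHS] at hray
  -- assemble: `e_per + κ' X / 2 ≥ eP(1) ≥ e + κ' c₁ L⁴ ≥ e_per - κc₁/2 + κ c₁`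
  have h1 : κ / (L : ℝ) ^ 4 * (c₁ * (L : ℝ) ^ 4) = κ * c₁ := by field_simp
  show c₁ * (L : ℝ) ^ 4 ≤ (star ψ ⬝ᵥ ((pairField dWaveFormFactor L)ᴴ * pairField dWaveFormFactor L) *ᵥ ψ).re
  by_contra hcon
  push Not at hcon
  have h5 : κ / (L : ℝ) ^ 4 * (1 / 2 * (star ψ ⬝ᵥ ((pairField dWaveFormFactor L)ᴴ * pairField dWaveFormFactor L) *ᵥ ψ).re) <
      κ / (L : ℝ) ^ 4 * (1 / 2 * (c₁ * (L : ℝ) ^ 4)) :=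
    mul_lt_mul_of_pos_left (by linarith) hκ'
  have h6 : κ / (L : ℝ) ^ 4 * (1 / 2 * (c₁ * (L : ℝ) ^ 4)) = κ * c₁ / 2 := by field_simp
  linarith

/-! ### The frozen block in the route's inline form -/

/-- The frozen-link block `H_F(k)` written with the hopping bilinears `Σ_b S_b(ρ(k_b))` (landed
`spinGaugedHubbardTorusWith_zero_zero_eq_linkDiag` + `submatrix_linkDiag`); unfolding `spinBil` and
`Q8.rep` gives the `let A` inlined in the twist-gap clause of the stub. [folklore] -/
theorem frozen_block_eq_spinBil (k : Bond L → Q8) :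
    (spinGaugedHubbardTorusWith Q8.rep L U 0 0).submatrix (fun s => (s, k)) (fun s => (s, k)) =
      -((∑ b : Bond L, spinBil b.1 (b.1.shift b.2) (Q8.rep (k b))) +
          (∑ b : Bond L, spinBil b.1 (b.1.shift b.2) (Q8.rep (k b)))ᴴ) +
        (U : ℂ) • ∑ x : FermionTorus 2 L, numberOp x 0 * numberOp x 1 := by
  rw [spinGaugedHubbardTorusWith_zero_zero_eq_linkDiag Q8.rep L U, submatrix_linkDiag]

end Main

section Registered

/-- **Registered helper `helper_penalisedEndpoint` of stub P3** (one-line restatement of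
`penalisedEndpoint_landed`, the penalised endpoint over the landed vocabulary). [folklore] -/
theorem helper_penalisedEndpoint : ∀ (U δ g₁ c₁ κ : ℝ) (L₂ L₃ : ℕ) (hδ : δ ∈ Set.Ioo (0 : ℝ) (1 / 2)) (hg₁ : 0 < g₁) (hc₁ : 0 < c₁) (hκ : 0 < κ) (hPen : ∀ g : ℝ, 0 < g → g ≤ g₁ → ∀ (L : ℕ) [NeZero L], L₂ ≤ L → Even L → ∀ ψ : {ik : Index L Q8 // HasParticleNumber L (2 * ⌊(1 - δ) * (L : ℝ) ^ 2 / 2⌋₊) ik} → ℂ, (ψ ≠ 0 ∧ ∃ E : ℝ, (spinGaugedHubbardTorus L U g + ((κ / (L : ℝ) ^ 4 : ℝ) : ℂ) • ((spinGaugedPairField L)ᴴ * spinGaugedPairField L)).toBlock (HasParticleNumber L (2 * ⌊(1 - δ) * (L : ℝ) ^ 2 / 2⌋₊)) (HasParticleNumber L (2 * ⌊(1 - δ) * (L : ℝ) ^ 2 / 2⌋₊)) *ᵥ ψ = (E : ℂ) • ψ ∧ ∀ φ : {ik : Index L Q8 // HasParticleNumber L (2 * ⌊(1 - δ) * (L :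 ℝ) ^ 2 / 2⌋₊) ik} → ℂ, E * (star φ ⬝ᵥ φ).re ≤ (star φ ⬝ᵥ (spinGaugedHubbardTorus L U g + ((κ / (L : ℝ) ^ 4 : ℝ) : ℂ) • ((spinGaugedPairField L)ᴴ * spinGaugedPairField L)).toBlock (HasParticleNumber L (2 * ⌊(1 - δ) * (L : ℝ) ^ 2 / 2⌋₊)) (HasParticleNumber L (2 * ⌊(1 - δ) * (L : ℝ) ^ 2 / 2⌋₊)) *ᵥ φ).re) → c₁ * (L : ℝ) ^ 4 * (star ψ ⬝ᵥ ψ).re ≤ (star ψ ⬝ᵥ ((spinGaugedPairField L)ᴴ * spinGaugedPairField L).toBlock (HasParticleNumber L (2 * ⌊(1 - δ) * (L : ℝ) ^ 2 / 2⌋₊)) (HasParticleNumber L (2 * ⌊(1 - δ) * (L : ℝ) ^ 2 / 2⌋₊)) *ᵥ ψ).re) (hTw : ∀ (L : ℕ) [NeZero L], L₃ ≤ L → Even L → ∀ k : Bond L → Q8, (∀ x, holonomy L k x = 1) → ∀ φ : Fock (Orb (FermionTorus 2 L)), φ ∈ (nParticleSubmodule (2 * ⌊(1 - δ) * (L : ℝ)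 ^ 2 / 2⌋₊) : Submodule ℂ (Fock (Orb (FermionTorus 2 L)))) → ((hubbardTorus 2 L 1 U).minEnergyOn (nParticleSubmodule (2 * ⌊(1 - δ) * (L : ℝ) ^ 2 / 2⌋₊) : Submodule ℂ (Fock (Orb (FermionTorus 2 L)))) - κ * c₁ / 2) * (star φ ⬝ᵥ φ).re ≤ (star φ ⬝ᵥ (spinGaugedHubbardTorusWith Q8.rep L U 0 0).submatrix (fun s => (s, k)) (fun s => (s, k)) *ᵥ φ).re), ∃ a : ℝ, 0 < a ∧ ∃ L₄ : ℕ, ∀ (L : ℕ) [NeZero L], L₄ ≤ L → Even L → ∀ ψ : Fock (Orb (FermionTorus 2 L)), star ψ ⬝ᵥ ψ = 1 → IsGroundStateInSector (hubbardTorus 2 L 1 U) (2 * ⌊(1 - δ) * (L : ℝ) ^ 2 / 2⌋₊) 0 ψ → a * (L : ℝ) ^ 4 ≤ (expect ((pairField dWaveFormFactor L)ᴴ * pairField dWaveFormFactor L) ψ).re :=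
  penalisedEndpoint_landed

end Registered

end Summit.HubbardSuperconductivity.ColourTheSpin.SgEndpoint

/-! ### The registered stub (verbatim text of `Sig.stub_penalisedEndpoint`) -/

namespace Summit.HubbardSuperconductivity.ColourTheSpin.SgEndpoint

-- exactly the `open`s of the route file / `Lines/penalty_chord.lean`, so that the text elaborates
-- to the same term as the strategist's `Sig.stub_penalisedEndpoint`
open scoped BigOperators Topology Manifold Classical MeasureTheory ProbabilityTheory Matrix InnerProductSpace ComplexConjugate ContinuousMap
open Filter Set Function TopologicalSpace MeasureTheory

set_option linter.style.longLine false in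
/-- **STUB P3 `stub_penalisedEndpoint` of line `penalty_chord`** (registered on
stmt-HubbardSuperconductivity-16272; the text is `Sig.stub_penalisedEndpoint` of
`Cruxes/SgEndpoint/Lines/penalty_chord.lean` VERBATIM = the strategist's door item `SgEndpointP`):
penalised corridor order + twist gap `≤ κc₁/2` ⇒ every normalised `(N_L, S^z = 0)`-sector ground state
of `hubbardTorus 2 L 1 U` has `a·L⁴ ≤ Re ⟨Δ_d†Δ_d⟩` eventually in even `L` (`a = c₁`). Proof:
`penalisedEndpoint_landed` (the inlined gauged objects are the landed ones by `rfl`; the inlined frozen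
block is `frozen_block_eq_spinBil`). [folklore] -/
theorem stub_penalisedEndpoint : open Literature.MathematicalPhysics.QuantumLattice in ∀ (U δ g₁ c₁ κ : ℝ) (L₂ L₃ : ℕ), 0 < U → δ ∈ Set.Ioo (0 : ℝ) (1 / 2) → 0 < g₁ → 0 < c₁ → 0 < κ → (∀ g : ℝ, 0 < g → g ≤ g₁ → ∀ (L : ℕ) [NeZero L], L₂ ≤ L → Even L → (let m : Fin 2 × ZMod 4 → Fin 2 × ZMod 4 → Fin 2 × ZMod 4 := fun u v => (u.1 + v.1, if u.1 = 0 then (if v.1 = 0 then u.2 + v.2 else v.2 - u.2) else if v.1 = 0 then u.2 + v.2 else 2 + v.2 - u.2); let iv : Fin 2 × ZMod 4 → Fin 2 × ZMod 4 := fun u => (u.1, if u.1 = 0 then -u.2 else u.2 + 2); let r : Fin 2 × ZMod 4 → Fin 2 → Fin 2 → ℂ := fun u σ τ => if u.1 = 0 then (if σ = τ then (if σ = 0 then Complex.I else -Complex.I) ^ u.2.val else 0) else if σ = τ then 0 else if σ = 0 then -(-Complex.I) ^ u.2.val else Complex.I ^ u.2.val; let hop := ∑ b : GaugedHubbard.Bond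 L, ∑ σ : Fin 2, ∑ τ : Fin 2, Matrix.kroneckerMap (· * ·) (creation (orb b.1 σ) * annihilation (orb (b.1.shift b.2) τ)) (Matrix.diagonal fun k : GaugedHubbard.Bond L → Fin 2 × ZMod 4 => r (k b) σ τ); let H := -(hop + hopᴴ) + ((U : ℝ) : ℂ) • Matrix.kroneckerMap (· * ·) (∑ x : FermionTorus 2 L, numberOp x 0 * numberOp x 1) (1 : Matrix (GaugedHubbard.Bond L → Fin 2 × ZMod 4) (GaugedHubbard.Bond L → Fin 2 × ZMod 4) ℂ) + ((g ^ 2 : ℝ) : ℂ) • Matrix.kroneckerMap (· * ·) (1 : Matrix (Finset (Orb (FermionTorus 2 L))) _ ℂ) (∑ b : GaugedHubbard.Bond L, Matrix.of fun k k' : GaugedHubbard.Bond L → Fin 2 × ZMod 4 => if k' = Function.update k b (k' b) then (if k b = k' b then (1 : ℂ) else 0) - 1 / 8 else 0) + ((1 / g ^ 2 : ℝ) : ℂ) • Matrix.kroneckerMap (· * ·) (1 : Matrix (Finset (Orb (FermionTorus 2 L))) _ ℂ) (Matrix.diagonal fun k : GaugedHubbard.Bond L → Fin 2 × ZMod 4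 => ∑ x : FermionTorus 2 L, (1 - (r (m (m (m (k (x, 0)) (k (x.shift 0, 1))) (iv (k (x.shift 1, 0)))) (iv (k (x, 1)))) 0 0 + r (m (m (m (k (x, 0)) (k (x.shift 0, 1))) (iv (k (x.shift 1, 0)))) (iv (k (x, 1)))) 1 1) / 2)); let P := ∑ b : GaugedHubbard.Bond L, (if b.2 = 0 then (1 : ℂ) else -1) • ∑ σ : Fin 2, ∑ τ : Fin 2, Matrix.kroneckerMap (· * ·) (annihilation (orb b.1 σ) * annihilation (orb (b.1.shift b.2) τ)) (Matrix.diagonal fun k : GaugedHubbard.Bond L → Fin 2 × ZMod 4 => if σ = 0 then r (k b) 1 τ else -r (k b) 0 τ); let Hκ := H + ((κ / (L : ℝ) ^ 4 : ℝ) : ℂ) • (Pᴴ * P); let p := fun ik : Finset (Orb (FermionTorus 2 L)) × (GaugedHubbard.Bond L → Fin 2 × ZMod 4) => ik.1.card = 2 * ⌊(1 - δ) * (L : ℝ) ^ 2 / 2⌋₊; ∀ ψ : {ik // p ik} → ℂ, (ψ ≠ 0 ∧ ∃ E : ℝ, Hκ.toBlock p p *ᵥ ψ = (E : ℂ) • ψ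 ∧ ∀ φ : {ik // p ik} → ℂ, E * (star φ ⬝ᵥ φ).re ≤ (star φ ⬝ᵥ Hκ.toBlock p p *ᵥ φ).re) → c₁ * (L : ℝ) ^ 4 * (star ψ ⬝ᵥ ψ).re ≤ (star ψ ⬝ᵥ (Pᴴ * P).toBlock p p *ᵥ ψ).re)) → (∀ (L : ℕ) [NeZero L], L₃ ≤ L → Even L → (let m : Fin 2 × ZMod 4 → Fin 2 × ZMod 4 → Fin 2 × ZMod 4 := fun u v => (u.1 + v.1, if u.1 = 0 then (if v.1 = 0 then u.2 + v.2 else v.2 - u.2) else if v.1 = 0 then u.2 + v.2 else 2 + v.2 - u.2); let iv : Fin 2 × ZMod 4 → Fin 2 × ZMod 4 := fun u => (u.1, if u.1 = 0 then -u.2 else u.2 + 2); let r : Fin 2 × ZMod 4 → Fin 2 → Fin 2 → ℂ := fun u σ τ => if u.1 = 0 then (if σ = τ then (if σ = 0 then Complex.I else -Complex.I) ^ u.2.val else 0) else if σ = τ then 0 else if σ = 0 then -(-Complex.I) ^ u.2.val else Complex.I ^ u.2.val; ∀ k : GaugedHubbard.Bond L → Fin 2 × ZMod 4, (∀ x : FermionTorus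 2 L, m (m (m (k (x, 0)) (k (x.shift 0, 1))) (iv (k (x.shift 1, 0)))) (iv (k (x, 1))) = ((0 : Fin 2), (0 : ZMod 4))) → (let hopF := ∑ b : GaugedHubbard.Bond L, ∑ σ : Fin 2, ∑ τ : Fin 2, r (k b) σ τ • (creation (orb b.1 σ) * annihilation (orb (b.1.shift b.2) τ)); let A := -(hopF + hopFᴴ) + ((U : ℝ) : ℂ) • ∑ x : FermionTorus 2 L, numberOp x 0 * numberOp x 1; ∀ φ : Fock (Orb (FermionTorus 2 L)), φ ∈ (nParticleSubmodule (2 * ⌊(1 - δ) * (L : ℝ) ^ 2 / 2⌋₊) : Submodule ℂ (Fock (Orb (FermionTorus 2 L)))) → ((hubbardTorus 2 L 1 U).minEnergyOn (nParticleSubmodule (2 * ⌊(1 - δ) * (L : ℝ) ^ 2 / 2⌋₊) : Submodule ℂ (Fock (Orb (FermionTorus 2 L)))) - (κ * c₁ / 2)) * (star φ ⬝ᵥ φ).re ≤ (star φ ⬝ᵥ A *ᵥ φ).re))) → ∃ a : ℝ, 0 < a ∧ ∃ L₄ : ℕ, (∀ (L : ℕ) [NeZero L], L₄ ≤ L → Even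 L → ∀ ψ : Fock (Orb (FermionTorus 2 L)), star ψ ⬝ᵥ ψ = 1 → IsGroundStateInSector (hubbardTorus 2 L 1 U) (2 * ⌊(1 - δ) * (L : ℝ) ^ 2 / 2⌋₊) 0 ψ → a * (L : ℝ) ^ 4 ≤ (expect ((pairField dWaveFormFactor L)ᴴ * pairField dWaveFormFactor L) ψ).re) := by
  intro U δ g₁ c₁ κ L₂ L₃ _ hδ hg₁ hc₁ hκ hPen hTw
  refine penalisedEndpoint_landed U δ g₁ c₁ κ L₂ L₃ hδ hg₁ hc₁ hκ hPen ?_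
  intro L _ hL hE k hk φ hφ
  rw [frozen_block_eq_spinBil]
  simp only [Literature.MathematicalPhysics.QuantumLattice.SpinGauged.spinBil]
  exact hTw L hL hE k hk φ hφ

end Summit.HubbardSuperconductivity.ColourTheSpin.SgEndpoint


/-! ### Tree-level composition of line `penalty_chord` with P3 discharged -/

namespace Summit.HubbardSuperconductivity.ColourTheSpin.SgEndpoint

open scoped BigOperators Topology Manifold Classical MeasureTheory ProbabilityTheory Matrix InnerProductSpace ComplexConjugate ContinuousMap
open Filter Set Function TopologicalSpace MeasureTheory
open Literature.Hubbard
open Literature.MathematicalPhysics.QuantumLattice (hasLongRangeOrder_even_of_le sum_pairFieldCorr_succ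
  dWaveFormFactor)

set_option linter.style.longLine false in
/-- **`SgEndpoint` from the two remaining stubs of line `penalty_chord`** (the strategist's glue
`SgEndpoint_of` of `Cruxes/SgEndpoint/Lines/penalty_chord.lean` with P3 replaced by the landed
`stub_penalisedEndpoint`; hypotheses = `Sig.stub_penaltyUpgrade` (P1) and `Sig.stub_twistGap` (P2)
VERBATIM, conclusion = the crux BY NAME): ready-made glue for `route edit --split SgEndpoint` into
P1 + P2. [folklore] -/
theorem sgEndpoint_of_penaltyUpgrade_of_twistGap : (open Literature.MathematicalPhysics.QuantumLattice in ∀ (U δ g₀ c' : ℝ) (L₁ : ℕ), 0 < U → δ ∈ Set.Ioo (0 : ℝ) (1 / 2) → 0 < g₀ → 0 < c' → (∀ g : ℝ, 0 < g → g ≤ g₀ → ∀ (L : ℕ) [NeZero L], L₁ ≤ L → Even L → (let m : Fin 2 × ZMod 4 → Fin 2 × ZMod 4 → Fin 2 × ZMod 4 := fun u v => (u.1 + v.1, if u.1 = 0 then (if v.1 = 0 then u.2 + v.2 else v.2 - u.2) else if v.1 = 0 then u.2 + v.2 else 2 + v.2 - u.2); let iv : Fin 2 × ZMod 4 → Fin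 2 × ZMod 4 := fun u => (u.1, if u.1 = 0 then -u.2 else u.2 + 2); let r : Fin 2 × ZMod 4 → Fin 2 → Fin 2 → ℂ := fun u σ τ => if u.1 = 0 then (if σ = τ then (if σ = 0 then Complex.I else -Complex.I) ^ u.2.val else 0) else if σ = τ then 0 else if σ = 0 then -(-Complex.I) ^ u.2.val else Complex.I ^ u.2.val; let hop := ∑ b : GaugedHubbard.Bond L, ∑ σ : Fin 2, ∑ τ : Fin 2, Matrix.kroneckerMap (· * ·) (creation (orb b.1 σ) * annihilation (orb (b.1.shift b.2) τ)) (Matrix.diagonal fun k : GaugedHubbard.Bond L → Fin 2 × ZMod 4 => r (k b) σ τ); let H := -(hop + hopᴴ) + ((U : ℝ) : ℂ) • Matrix.kroneckerMap (· * ·) (∑ x : FermionTorus 2 L, numberOp x 0 * numberOp x 1) (1 : Matrix (GaugedHubbard.Bond L → Fin 2 × ZMod 4) (GaugedHubbard.Bond L → Fin 2 × ZMod 4) ℂ) + ((g ^ 2 : ℝ) : ℂ) • Matrix.kroneckerMap (· * ·) (1 : Matrix (Finset (Orb (FermionTorus 2 L))) _ ℂ) (∑ b : GaugedHubbard.Bond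 L, Matrix.of fun k k' : GaugedHubbard.Bond L → Fin 2 × ZMod 4 => if k' = Function.update k b (k' b) then (if k b = k' b then (1 : ℂ) else 0) - 1 / 8 else 0) + ((1 / g ^ 2 : ℝ) : ℂ) • Matrix.kroneckerMap (· * ·) (1 : Matrix (Finset (Orb (FermionTorus 2 L))) _ ℂ) (Matrix.diagonal fun k : GaugedHubbard.Bond L → Fin 2 × ZMod 4 => ∑ x : FermionTorus 2 L, (1 - (r (m (m (m (k (x, 0)) (k (x.shift 0, 1))) (iv (k (x.shift 1, 0)))) (iv (k (x, 1)))) 0 0 + r (m (m (m (k (x, 0)) (k (x.shift 0, 1))) (iv (k (x.shift 1, 0)))) (iv (k (x, 1)))) 1 1) / 2)); let P := ∑ b : GaugedHubbard.Bond L, (if b.2 = 0 then (1 : ℂ) else -1) • ∑ σ : Fin 2, ∑ τ : Fin 2, Matrix.kroneckerMap (· * ·) (annihilation (orb b.1 σ) * annihilation (orb (b.1.shift b.2) τ)) (Matrix.diagonal fun k : GaugedHubbard.Bond L → Fin 2 × ZMod 4 => if σ = 0 then r (k b) 1 τ else -r (k b) 0 τ); let p := fun ik : Finset (Orb (FermionTorus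 2 L)) × (GaugedHubbard.Bond L → Fin 2 × ZMod 4) => ik.1.card = 2 * ⌊(1 - δ) * (L : ℝ) ^ 2 / 2⌋₊; ∀ ψ : {ik // p ik} → ℂ, (ψ ≠ 0 ∧ ∃ E : ℝ, H.toBlock p p *ᵥ ψ = (E : ℂ) • ψ ∧ ∀ φ : {ik // p ik} → ℂ, E * (star φ ⬝ᵥ φ).re ≤ (star φ ⬝ᵥ H.toBlock p p *ᵥ φ).re) → c' * (L : ℝ) ^ 4 * (star ψ ⬝ᵥ ψ).re ≤ (star ψ ⬝ᵥ (Pᴴ * P).toBlock p p *ᵥ ψ).re)) → ∃ g₁ : ℝ, 0 < g₁ ∧ ∃ c₁ : ℝ, 0 < c₁ ∧ ∃ κ : ℝ, 0 < κ ∧ ∃ L₂ : ℕ, (∀ g : ℝ, 0 < g → g ≤ g₁ → ∀ (L : ℕ) [NeZero L], L₂ ≤ L → Even L → (let m : Fin 2 × ZMod 4 → Fin 2 × ZMod 4 → Fin 2 × ZMod 4 := fun u v => (u.1 + v.1, if u.1 = 0 then (if v.1 = 0 then u.2 + v.2 else v.2 - u.2) else if v.1 = 0 then u.2 + v.2 else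 2 + v.2 - u.2); let iv : Fin 2 × ZMod 4 → Fin 2 × ZMod 4 := fun u => (u.1, if u.1 = 0 then -u.2 else u.2 + 2); let r : Fin 2 × ZMod 4 → Fin 2 → Fin 2 → ℂ := fun u σ τ => if u.1 = 0 then (if σ = τ then (if σ = 0 then Complex.I else -Complex.I) ^ u.2.val else 0) else if σ = τ then 0 else if σ = 0 then -(-Complex.I) ^ u.2.val else Complex.I ^ u.2.val; let hop := ∑ b : GaugedHubbard.Bond L, ∑ σ : Fin 2, ∑ τ : Fin 2, Matrix.kroneckerMap (· * ·) (creation (orb b.1 σ) * annihilation (orb (b.1.shift b.2) τ)) (Matrix.diagonal fun k : GaugedHubbard.Bond L → Fin 2 × ZMod 4 => r (k b) σ τ); let H := -(hop + hopᴴ) + ((U : ℝ) : ℂ) • Matrix.kroneckerMap (· * ·) (∑ x : FermionTorus 2 L, numberOp x 0 * numberOp x 1) (1 : Matrix (GaugedHubbard.Bond L → Fin 2 × ZMod 4) (GaugedHubbard.Bond L → Fin 2 × ZMod 4) ℂ) + ((g ^ 2 : ℝ) : ℂ) • Matrix.kroneckerMap (· * ·) (1 : Matrix (Finset (Orb (FermionTorus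 2 L))) _ ℂ) (∑ b : GaugedHubbard.Bond L, Matrix.of fun k k' : GaugedHubbard.Bond L → Fin 2 × ZMod 4 => if k' = Function.update k b (k' b) then (if k b = k' b then (1 : ℂ) else 0) - 1 / 8 else 0) + ((1 / g ^ 2 : ℝ) : ℂ) • Matrix.kroneckerMap (· * ·) (1 : Matrix (Finset (Orb (FermionTorus 2 L))) _ ℂ) (Matrix.diagonal fun k : GaugedHubbard.Bond L → Fin 2 × ZMod 4 => ∑ x : FermionTorus 2 L, (1 - (r (m (m (m (k (x, 0)) (k (x.shift 0, 1))) (iv (k (x.shift 1, 0)))) (iv (k (x, 1)))) 0 0 + r (m (m (m (k (x, 0)) (k (x.shift 0, 1))) (iv (k (x.shift 1, 0)))) (iv (k (x, 1)))) 1 1) / 2)); let P := ∑ b : GaugedHubbard.Bond L, (if b.2 = 0 then (1 : ℂ) else -1) • ∑ σ : Fin 2, ∑ τ : Fin 2, Matrix.kroneckerMap (· * ·) (annihilation (orb b.1 σ) * annihilation (orb (b.1.shift b.2) τ)) (Matrix.diagonal fun k : GaugedHubbard.Bond L → Fin 2 × ZMod 4 => if σ = 0 then r (k b) 1 τ else -r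 (k b) 0 τ); let Hκ := H + ((κ / (L : ℝ) ^ 4 : ℝ) : ℂ) • (Pᴴ * P); let p := fun ik : Finset (Orb (FermionTorus 2 L)) × (GaugedHubbard.Bond L → Fin 2 × ZMod 4) => ik.1.card = 2 * ⌊(1 - δ) * (L : ℝ) ^ 2 / 2⌋₊; ∀ ψ : {ik // p ik} → ℂ, (ψ ≠ 0 ∧ ∃ E : ℝ, Hκ.toBlock p p *ᵥ ψ = (E : ℂ) • ψ ∧ ∀ φ : {ik // p ik} → ℂ, E * (star φ ⬝ᵥ φ).re ≤ (star φ ⬝ᵥ Hκ.toBlock p p *ᵥ φ).re) → c₁ * (L : ℝ) ^ 4 * (star ψ ⬝ᵥ ψ).re ≤ (star ψ ⬝ᵥ (Pᴴ * P).toBlock p p *ᵥ ψ).re))) → (open Literature.MathematicalPhysics.QuantumLattice in ∀ (U δ g₀ c' : ℝ) (L₁ : ℕ), 0 < U → δ ∈ Set.Ioo (0 : ℝ) (1 / 2) → 0 < g₀ → 0 < c' → (∀ g : ℝ, 0 < g → g ≤ g₀ → ∀ (L : ℕ) [NeZero L], L₁ ≤ L → Even L → (let m : Fin 2 × ZMod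 4 → Fin 2 × ZMod 4 → Fin 2 × ZMod 4 := fun u v => (u.1 + v.1, if u.1 = 0 then (if v.1 = 0 then u.2 + v.2 else v.2 - u.2) else if v.1 = 0 then u.2 + v.2 else 2 + v.2 - u.2); let iv : Fin 2 × ZMod 4 → Fin 2 × ZMod 4 := fun u => (u.1, if u.1 = 0 then -u.2 else u.2 + 2); let r : Fin 2 × ZMod 4 → Fin 2 → Fin 2 → ℂ := fun u σ τ => if u.1 = 0 then (if σ = τ then (if σ = 0 then Complex.I else -Complex.I) ^ u.2.val else 0) else if σ = τ then 0 else if σ = 0 then -(-Complex.I) ^ u.2.val else Complex.I ^ u.2.val; let hop := ∑ b : GaugedHubbard.Bond L, ∑ σ : Fin 2, ∑ τ : Fin 2, Matrix.kroneckerMap (· * ·) (creation (orb b.1 σ) * annihilation (orb (b.1.shift b.2) τ)) (Matrix.diagonal fun k : GaugedHubbard.Bond L → Fin 2 × ZMod 4 => r (k b) σ τ); let H := -(hop + hopᴴ) + ((U : ℝ) : ℂ) • Matrix.kroneckerMap (· * ·) (∑ x : FermionTorus 2 L, numberOp x 0 * numberOp x 1) (1 : Matrix (GaugedHubbard.Bond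 L → Fin 2 × ZMod 4) (GaugedHubbard.Bond L → Fin 2 × ZMod 4) ℂ) + ((g ^ 2 : ℝ) : ℂ) • Matrix.kroneckerMap (· * ·) (1 : Matrix (Finset (Orb (FermionTorus 2 L))) _ ℂ) (∑ b : GaugedHubbard.Bond L, Matrix.of fun k k' : GaugedHubbard.Bond L → Fin 2 × ZMod 4 => if k' = Function.update k b (k' b) then (if k b = k' b then (1 : ℂ) else 0) - 1 / 8 else 0) + ((1 / g ^ 2 : ℝ) : ℂ) • Matrix.kroneckerMap (· * ·) (1 : Matrix (Finset (Orb (FermionTorus 2 L))) _ ℂ) (Matrix.diagonal fun k : GaugedHubbard.Bond L → Fin 2 × ZMod 4 => ∑ x : FermionTorus 2 L, (1 - (r (m (m (m (k (x, 0)) (k (x.shift 0, 1))) (iv (k (x.shift 1, 0)))) (iv (k (x, 1)))) 0 0 + r (m (m (m (k (x, 0)) (k (x.shift 0, 1))) (iv (k (x.shift 1, 0)))) (iv (k (x, 1)))) 1 1) / 2)); let P := ∑ b : GaugedHubbard.Bond L, (if b.2 = 0 then (1 : ℂ) else -1) • ∑ σ : Fin 2, ∑ τ : Fin 2, Matrix.kroneckerMap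 (· * ·) (annihilation (orb b.1 σ) * annihilation (orb (b.1.shift b.2) τ)) (Matrix.diagonal fun k : GaugedHubbard.Bond L → Fin 2 × ZMod 4 => if σ = 0 then r (k b) 1 τ else -r (k b) 0 τ); let p := fun ik : Finset (Orb (FermionTorus 2 L)) × (GaugedHubbard.Bond L → Fin 2 × ZMod 4) => ik.1.card = 2 * ⌊(1 - δ) * (L : ℝ) ^ 2 / 2⌋₊; ∀ ψ : {ik // p ik} → ℂ, (ψ ≠ 0 ∧ ∃ E : ℝ, H.toBlock p p *ᵥ ψ = (E : ℂ) • ψ ∧ ∀ φ : {ik // p ik} → ℂ, E * (star φ ⬝ᵥ φ).re ≤ (star φ ⬝ᵥ H.toBlock p p *ᵥ φ).re) → c' * (L : ℝ) ^ 4 * (star ψ ⬝ᵥ ψ).re ≤ (star ψ ⬝ᵥ (Pᴴ * P).toBlock p p *ᵥ ψ).re)) → ∀ ε : ℝ, 0 < ε → ∃ L₃ : ℕ, (∀ (L : ℕ) [NeZero L], L₃ ≤ L → Even L → (let m : Fin 2 × ZMod 4 → Fin 2 × ZMod 4 → Fin 2 × ZMod 4 := fun u v => (u.1 + v.1, if u.1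 = 0 then (if v.1 = 0 then u.2 + v.2 else v.2 - u.2) else if v.1 = 0 then u.2 + v.2 else 2 + v.2 - u.2); let iv : Fin 2 × ZMod 4 → Fin 2 × ZMod 4 := fun u => (u.1, if u.1 = 0 then -u.2 else u.2 + 2); let r : Fin 2 × ZMod 4 → Fin 2 → Fin 2 → ℂ := fun u σ τ => if u.1 = 0 then (if σ = τ then (if σ = 0 then Complex.I else -Complex.I) ^ u.2.val else 0) else if σ = τ then 0 else if σ = 0 then -(-Complex.I) ^ u.2.val else Complex.I ^ u.2.val; ∀ k : GaugedHubbard.Bond L → Fin 2 × ZMod 4, (∀ x : FermionTorus 2 L, m (m (m (k (x, 0)) (k (x.shift 0, 1))) (iv (k (x.shift 1, 0)))) (iv (k (x, 1))) = ((0 : Fin 2), (0 : ZMod 4))) → (let hopF := ∑ b : GaugedHubbard.Bond L, ∑ σ : Fin 2, ∑ τ : Fin 2, r (k b) σ τ • (creation (orb b.1 σ) * annihilation (orb (b.1.shift b.2) τ)); let A := -(hopF + hopFᴴ) + ((U : ℝ) : ℂ) • ∑ x : FermionTorus 2 L, numberOp x 0 * numberOp x 1; ∀ φ : Fock (Orb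 (FermionTorus 2 L)), φ ∈ (nParticleSubmodule (2 * ⌊(1 - δ) * (L : ℝ) ^ 2 / 2⌋₊) : Submodule ℂ (Fock (Orb (FermionTorus 2 L)))) → ((hubbardTorus 2 L 1 U).minEnergyOn (nParticleSubmodule (2 * ⌊(1 - δ) * (L : ℝ) ^ 2 / 2⌋₊) : Submodule ℂ (Fock (Orb (FermionTorus 2 L)))) - (ε)) * (star φ ⬝ᵥ φ).re ≤ (star φ ⬝ᵥ A *ᵥ φ).re)))) → Summit.HubbardSuperconductivity.HubbardSuperconductivity.Theses.ColourTheSpin.SgEndpoint := by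
  intro h1 h3
  unfold Summit.HubbardSuperconductivity.HubbardSuperconductivity.Theses.ColourTheSpin.SgEndpoint
  intro U δ g₀ c' L₁ hU hδ hg hc hC N ψ hadm
  obtain ⟨g₁, hg₁, c₁, hc₁, κ, hκ, L₂, hP⟩ := h1 U δ g₀ c' L₁ hU hδ hg hc hC
  obtain ⟨L₃, hT⟩ := h3 U δ g₀ c' L₁ hU hδ hg hc hC (κ * c₁ / 2) (by positivity)
  obtain ⟨a, ha, L₄, hE⟩ := stub_penalisedEndpoint U δ g₁ c₁ κ L₂ L₃ hU hδ hg₁ hc₁ hκ hP hT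
  refine hasLongRangeOrder_even_of_le dWaveFormFactor ψ (fun n hn => (hadm (n + 1) hn).2.1) ha L₄
    (fun n hn hK => ?_)
  rw [sum_pairFieldCorr_succ dWaveFormFactor ψ n]
  obtain ⟨hNn, hnorm, hgs⟩ := hadm (n + 1) hn
  rw [hNn] at hgs
  exact hE (n + 1) hK hn (ψ (n + 1)) hnorm hgs

end Summit.HubbardSuperconductivity.ColourTheSpin.SgEndpoint

end
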